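import Summits.BirchSwinnertonDyer.BirchSwinnertonDyer.Theses.ShadowIsolation
import Summits.BirchSwinnertonDyer.BirchSwinnertonDyer.Theses.SelmerRank
import Summits.BirchSwinnertonDyer.BirchSwinnertonDyer.Theses.Squeeze
import Literature.NumberTheory.EllipticCurves.NonEisensteinPrimeOfSurjective
import Literature.NumberTheory.EllipticCurves.KatoRankBound
import Literature.NumberTheory.EllipticCurves.LeadingTerm
import Literature.NumberTheory.EllipticCurves.BSDSelmer
import Literature.NumberTheory.EllipticCurves.KuriharaNumberKimStructure
import Literature.NumberTheory.EllipticCurves.KuriharaNumberKimNonvanishing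

/-!
# Strategy census companion — crux `SelmerRankUB` (stmt-BirchSwinnertonDyer-0130)

Typed evidence for `Cruxes/SelmerRankUB/STRATEGY-CENSUS.md` (crux-strategist before the lead,
unit `cstrat-stmt-BirchSwinnertonDyer-0130-b1`). Every claim of the census that is a statement
about the tree is certified here. Nothing in this file closes the crux.

Crux (shared verbatim by routes SelmerRank #3 and ShadowIsolation #4):
`∀ W [IsElliptic] [IsGloballyMinimal] p [Fact p.Prime], 5 ≤ p → good p → p ∤ a_p → ρ̄_{E,p} surjective →
   corank_ℤp Sel_p∞(E/ℚ) ≤ ord_{s=1} L(E,s)`.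

§1 dictionary (Greenberg's identity, in tree) · §2 the decomposition UB ⇐ NoExcessRank ∧ ShaCotorsionBigImage
(split glue, PROVED) and necessity of the rank child · §3 junctions: the Ш-child is delivered INSIDE each wanting
route (ShadowIsolation: Isolation ∧ Shadow; SelmerRank: ShaPFinite) · §4 route-level certificates: both deciding
theorems survive with `SelmerRankUB` replaced by `SqueezeUB` · §5 exact cells (GZK ∧ parity ∧ open core) ·
§6 the cyclotomic (Kato) line and why its second stub is strictly harder · §7 typed S⁺ candidates ·
§8 the tame (Kurihara-number) ignition is the crux modulo Kim's structure theorems (costume certificate).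
-/

namespace Summit.BirchSwinnertonDyer.BirchSwinnertonDyer.Cruxes.SelmerRankUB.Census

open Summit.BirchSwinnertonDyer.BirchSwinnertonDyer.Theses
open Literature.NumberTheory.EllipticCurves

/-! ## §1 Dictionary: UB ⇔ rank + corank Ш[p^∞] ≤ r_an -/

/-- The two route copies of the crux are the same proposition. -/
theorem crux_twins : ShadowIsolation.SelmerRankUB ↔ SelmerRank.SelmerRankUB := Iff.rfl

/-- UB restated through Greenberg's corank identity (tree theorem
`WeierstrassCurve.selmerCorank_eq_mordellWeilRank_add_holds`): at a big-image good ordinary `p ≥ 5`,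
`rank E(ℚ) + corank_ℤp Ш(E)[p^∞] ≤ ord_{s=1} L(E,s)`. -/
theorem crux_iff_rank_add_shaCorank_le :
    ShadowIsolation.SelmerRankUB ↔
      ∀ (W : WeierstrassCurve ℚ) [W.IsElliptic] [W.IsGloballyMinimal] (p : ℕ) [Fact p.Prime],
        5 ≤ p → W.HasGoodReductionAtPrime p → ¬ (p : ℤ) ∣ W.frobeniusTrace p →
        W.HasSurjectiveModNGaloisRep p → W.mordellWeilRank + W.shaCorank p ≤ W.analyticRank := by
  constructor
  · intro h W _ _ p _ h5 hg ho hs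
    have := h W p h5 hg ho hs
    rwa [W.selmerCorank_eq_mordellWeilRank_add_holds p] at this
  · intro h W _ _ p _ h5 hg ho hs
    rw [W.selmerCorank_eq_mordellWeilRank_add_holds p]
    exact h W p h5 hg ho hs

/-! ## §2 The decomposition (children of the split) -/

/-- Child A — NO EXCESS RANK: `rank E(ℚ) ≤ ord_{s=1} L(E,s)` for every elliptic `E/ℚ`. VERBATIM the
statement of items stmt-BirchSwinnertonDyer-0145 / 0496 (`Squeeze.SqueezeUB` = `Squeeze.SqueezeUBR2` =
`LeadingTerm.SqueezeUBR2` = `HigherGrossZagier.SqueezeUB(R2)`), so the child DEDUPS onto that chain. -/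
def NoExcessRank : Prop :=
  ∀ (W : WeierstrassCurve ℚ) [W.IsElliptic], W.mordellWeilRank ≤ W.analyticRank

/-- Child B — Ш[p^∞]-COTORSION AT A BIG-IMAGE GOOD ORDINARY PRIME `p ≥ 5` (junction node: see §3). -/
def ShaCotorsionBigImage : Prop :=
  ∀ (W : WeierstrassCurve ℚ) [W.IsElliptic] [W.IsGloballyMinimal] (p : ℕ) [Fact p.Prime],
    5 ≤ p → W.HasGoodReductionAtPrime p → ¬ (p : ℤ) ∣ W.frobeniusTrace p →
    W.HasSurjectiveModNGaloisRep p → W.shaCorank p = 0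

theorem noExcessRank_iff_squeezeUBR2 : NoExcessRank ↔ Squeeze.SqueezeUBR2 := Iff.rfl
theorem noExcessRank_iff_squeezeUB : NoExcessRank ↔ Squeeze.SqueezeUB := Iff.rfl

/-- **THE SPLIT GLUE** (`SelmerRankUB_of_subs`): no excess rank ∧ Ш[p^∞]-cotorsion at big-image
good ordinary `p` ⟹ the crux. Pure bookkeeping over Greenberg's identity. -/
theorem selmerRankUB_of_subs : NoExcessRank → ShaCotorsionBigImage → ShadowIsolation.SelmerRankUB := by
  intro hA hB W _ _ p _ h5 hg ho hs
  rw [W.selmerCorank_eq_mordellWeilRank_add_holds p, hB W p h5 hg ho hs, add_zero]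
  exact hA W

/-- The same glue under route SelmerRank's name of the crux. -/
theorem selmerRank_selmerRankUB_of_subs :
    NoExcessRank → ShaCotorsionBigImage → SelmerRank.SelmerRankUB :=
  selmerRankUB_of_subs

/-- NECESSITY of child A on the crux's own locus: UB ⟹ `rank ≤ r_an` for every globally minimal
`E` admitting a big-image good ordinary prime `p ≥ 5` (i.e. every non-CM curve, by Serre's theorem
`serre_open_image_holds` + `exists_goodOrdinary_surjective_of_not_hasCM`, both in tree). So the rank
child loses nothing but the CM surplus of the verbatim 0145 statement. -/
theorem rank_le_analyticRank_of_crux (h : ShadowIsolation.SelmerRankUB) :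
    ∀ (W : WeierstrassCurve ℚ) [W.IsElliptic] [W.IsGloballyMinimal] (p : ℕ) [Fact p.Prime],
      5 ≤ p → W.HasGoodReductionAtPrime p → ¬ (p : ℤ) ∣ W.frobeniusTrace p →
      W.HasSurjectiveModNGaloisRep p → W.mordellWeilRank ≤ W.analyticRank := by
  intro W _ _ p _ h5 hg ho hs
  have := h W p h5 hg ho hs
  rw [W.selmerCorank_eq_mordellWeilRank_add_holds p] at this
  omega

/-- Child B is NOT a consequence of the crux alone (the split is a strict strengthening): UB only bounds
`corank Ш[p^∞]` by the DEFICIT `r_an − rank`. Recorded as the exact residual statement. -/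
theorem shaCorank_le_deficit_of_crux (h : ShadowIsolation.SelmerRankUB) :
    ∀ (W : WeierstrassCurve ℚ) [W.IsElliptic] [W.IsGloballyMinimal] (p : ℕ) [Fact p.Prime],
      5 ≤ p → W.HasGoodReductionAtPrime p → ¬ (p : ℤ) ∣ W.frobeniusTrace p →
      W.HasSurjectiveModNGaloisRep p → W.shaCorank p ≤ W.analyticRank - W.mordellWeilRank := by
  intro W _ _ p _ h5 hg ho hs
  have := h W p h5 hg ho hs
  rw [W.selmerCorank_eq_mordellWeilRank_add_holds p] at this
  omega

/-! ## §3 Junctions: child B is delivered inside each wanting route -/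

/-- Route SelmerRank: its own crux `SelmerRankShaPFinite` (stmt-0132, a binder of `SelmerRank.closes`)
gives child B through the landed `Literature.BSD.shaCorank_eq_zero_of_finite`. -/
theorem shaCotorsionBigImage_of_shaPFinite (h : SelmerRank.SelmerRankShaPFinite) :
    ShaCotorsionBigImage :=
  fun W _ _ p _ _ _ _ _ => Literature.BSD.shaCorank_eq_zero_of_finite W p (h W p)

/-- Support item `ShadowIsolation.ShaUnboundedOfCorank` (stmt-15490), PROVED — extracted verbatim from the
inline proof inside the certified `ShadowIsolation.closes` (pure algebra of `zpCorank`): a positive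
Ш-corank yields Ш-elements of every exact order `p ^ n`. Candidate closing proof for stmt-15490. -/
theorem shaUnboundedOfCorank_holds : ShadowIsolation.ShaUnboundedOfCorank := by
  classical
  have hzero : ∀ (B : Type) [AddCommGroup B] [Finite B] (p : ℕ) [Fact p.Prime],
      Literature.NumberTheory.EllipticCurves.zpCorank B p = 0 :=
    fun B _ _ p _ => Literature.BSD.zpCorank_eq_zero_of_finite B p
  intro W _ p hp hcor n
  have hpp : p.Prime := hp.out
  by_contra hno
  push Not at hno
  apply hcor
  set A : AddSubgroup ↥W.sha := AddCommGroup.primaryComponent (↥W.sha) p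
  show Literature.NumberTheory.EllipticCurves.zpCorank (↥A) p = 0
  -- (B1) `p ^ n` kills `A`
  have hkill : ∀ a : ↥A, p ^ n • a = 0 := by
    intro a
    obtain ⟨k, hk⟩ : ∃ k : ℕ, p ^ k • (a : ↥W.sha) = 0 := a.2
    have hdvd : addOrderOf (a : ↥W.sha) ∣ p ^ k := addOrderOf_dvd_of_nsmul_eq_zero hk
    obtain ⟨m, -, hm⟩ := (Nat.dvd_prime_pow hpp).1 hdvd
    by_cases hmn : n ≤ m
    · exfalso
      have hne : addOrderOf (a : ↥W.sha) ≠ 0 := by rw [hm]; exact pow_ne_zero _ hpp.ne_zero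
      have hdiv : p ^ n ∣ addOrderOf (a : ↥W.sha) := by rw [hm]; exact pow_dvd_pow p hmn
      exact hno _ (addOrderOf_nsmul_addOrderOf_sub hne hdiv)
    · push Not at hmn
      have hdiv : addOrderOf (a : ↥W.sha) ∣ p ^ n := by rw [hm]; exact pow_dvd_pow p hmn.le
      apply Subtype.ext
      rw [AddSubgroupClass.coe_nsmul, ZeroMemClass.coe_zero]
      exact addOrderOf_dvd_iff_nsmul_eq_zero.mp hdiv
  -- (B2) `A[p]` is finite, else the corank formula is the junk value `0`
  haveI hfinp : Finite ↥(AddSubgroup.torsionBy (↥A) (p : ℤ)) := by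
    by_contra hinf
    apply hcor
    show Literature.NumberTheory.EllipticCurves.zpCorank (↥A) p = 0
    unfold Literature.NumberTheory.EllipticCurves.zpCorank
    letI : Module (ZMod p) (AddSubgroup.torsionBy (↥A) (p : ℤ)) := AddSubgroup.torsionBy.zmodModule
    have h0 : Module.finrank (ZMod p) (AddSubgroup.torsionBy (↥A) (p : ℤ)) = 0 := by
      apply Module.finrank_of_not_finite
      intro hf
      exact hinf (Module.finite_of_finite (ZMod p))
    rw [h0, Nat.zero_sub]
  -- (B3) hence `A = A[p^n]` is finite and has corank `0`
  haveI : Finite ↥(AddSubgroup.torsionBy (↥A) ((p ^ n : ℕ) : ℤ)) :=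
    Literature.NumberTheory.EllipticCurves.finite_torsionBy_pow (↥A) p n
  haveI : Finite ↥A :=
    Finite.of_injective
      (fun a : ↥A => (⟨a, AddSubgroup.torsionBy.nsmul_iff.mpr (hkill a)⟩ :
        ↥(AddSubgroup.torsionBy (↥A) ((p ^ n : ℕ) : ℤ))))
      (fun a b h => by simpa using congrArg Subtype.val h)
  exact hzero (↥A) p

/-- Route ShadowIsolation: its two lead cruxes (Isolation ∧ Shadow) give Ш[p^∞]-cotorsion at every
good ordinary `p ≥ 5` with `E[p]` IRREDUCIBLE (the first conjunct of the route target
`ShadowIsolationThesis`), unconditionally in the support item (proved above). Pure logic: the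
predicate asserted by `PhantomShadow` is the one negated by `IsolationOfAccidentalZeros`. -/
theorem shaCorank_eq_zero_of_isolation_of_shadow (hIso : ShadowIsolation.IsolationOfAccidentalZeros)
    (hSh : ShadowIsolation.PhantomShadow) :
    ∀ (W : WeierstrassCurve ℚ) [W.IsElliptic] [W.IsGloballyMinimal] (p : ℕ) [Fact p.Prime],
      5 ≤ p → W.HasGoodReductionAtPrime p → ¬ (p : ℤ) ∣ W.frobeniusTrace p →
      W.HasIrreducibleModPGaloisRep p → W.shaCorank p = 0 := by
  intro W _ _ p _ h5 hgood hord hirr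
  by_contra hne
  obtain ⟨n₀, hn₀⟩ := hIso W p h5 hgood hord hirr
  obtain ⟨σ, hσ⟩ := shaUnboundedOfCorank_holds W p hne (max n₀ 1)
  exact hn₀ (max n₀ 1) (le_max_left _ _)
    (hSh W p h5 hgood hord hirr (max n₀ 1) (le_max_right _ _) ⟨σ, hσ⟩)

/-- Hence child B inside route ShadowIsolation (surjective ⟹ irreducible, tree theorem
`hasIrreducibleModPGaloisRep_of_hasSurjectiveModNGaloisRep`). -/
theorem shaCotorsionBigImage_of_isolation_of_shadow (hIso : ShadowIsolation.IsolationOfAccidentalZeros)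
    (hSh : ShadowIsolation.PhantomShadow) : ShaCotorsionBigImage := by
  intro W _ _ p hp h5 hgood hord hsurj
  haveI : NeZero ((p : ℕ) : ℚ) := ⟨Nat.cast_ne_zero.mpr hp.out.ne_zero⟩
  exact shaCorank_eq_zero_of_isolation_of_shadow hIso hSh W p h5 hgood hord
    (hasIrreducibleModPGaloisRep_of_hasSurjectiveModNGaloisRep W p hsurj)

/-! ## §4 Route-level certificates: `SelmerRankUB` is eliminable in favour of `SqueezeUB` in BOTH routes -/

/-- Route ShadowIsolation decides the summit with the crux `SelmerRankUB` (stmt-0130) replaced by the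
p-free no-excess-rank statement (stmt-0145/0496): every other binder unchanged. -/
theorem shadowIsolation_closes_noExcessRank (hIso : ShadowIsolation.IsolationOfAccidentalZeros)
    (hSh : ShadowIsolation.PhantomShadow) (hA : NoExcessRank) (hLB : ShadowIsolation.SelmerRankLB)
    (hSI : ShadowIsolation.SelmerRankSmallImage) (hRed : ShadowIsolation.ShaCotorsionReducible) :
    _root_.BirchSwinnertonDyer :=
  ShadowIsolation.closes hIso hSh
    (selmerRankUB_of_subs hA (shaCotorsionBigImage_of_isolation_of_shadow hIso hSh)) hLB hSI hRed

/-- Route SelmerRank decides the summit with `SelmerRankUB` replaced by the no-excess-rank statement: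
its own binder `SelmerRankShaPFinite` delivers child B. -/
theorem selmerRank_closes_noExcessRank (h₂ : SelmerRank.SelmerRankRankTwo) (hA : NoExcessRank)
    (hLB : SelmerRank.SelmerRankLB) (hSI : SelmerRank.SelmerRankSmallImage)
    (hSha : SelmerRank.SelmerRankShaPFinite) : _root_.BirchSwinnertonDyer :=
  SelmerRank.closes h₂ (selmerRank_selmerRankUB_of_subs hA (shaCotorsionBigImage_of_shaPFinite hSha))
    hLB hSI hSha

/-! ## §5 Exact cells: what is known, and the open core -/

/-- GZK SELMER CELL (theorem in print: Gross–Zagier–Kolyvagin incl. finiteness of Ш in analytic rank ≤ 1;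
Kato at rank 0): `r_an ≤ 1 ⟹ corank Sel_p∞ = r_an` at every prime. -/
def GZKSelmerCell : Prop :=
  ∀ (W : WeierstrassCurve ℚ) [W.IsElliptic] (p : ℕ) [Fact p.Prime],
    W.analyticRank ≤ 1 → W.selmerCorank p = W.analyticRank

/-- PARITY CELL (theorem in print: Dokchitser–Dokchitser 2010 Thm 1.4 = tree fact bsd.S19
`selmerCorank_mod_two_eq`, pointwise). -/
def ParityCell : Prop :=
  ∀ (W : WeierstrassCurve ℚ) [W.IsElliptic] (p : ℕ) [Fact p.Prime],
    W.selmerCorank p % 2 = W.analyticRank % 2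

/-- THE OPEN CORE `UBSel4` (all of the open content of the crux): at a big-image good ordinary `p ≥ 5`,
a curve of analytic rank ≥ 2 whose p^∞-Selmer corank is ≥ 4 and of the same parity as r_an has corank
≤ r_an. First cell (corank, r_an) = (4, 2): `w = +1, L(E,1) = 0, corank_ℤp Sel_p∞ = 4 ⟹ L''(E,1) = 0`,
equivalently `L''(E,1) ≠ 0 ⟹ corank ≤ 2` — a SECOND central derivative must cap a Selmer group. -/
def UBSel4 : Prop :=
  ∀ (W : WeierstrassCurve ℚ) [W.IsElliptic] [W.IsGloballyMinimal] (p : ℕ) [Fact p.Prime],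
    5 ≤ p → W.HasGoodReductionAtPrime p → ¬ (p : ℤ) ∣ W.frobeniusTrace p →
    W.HasSurjectiveModNGaloisRep p → 2 ≤ W.analyticRank → 4 ≤ W.selmerCorank p →
    W.selmerCorank p % 2 = W.analyticRank % 2 → W.selmerCorank p ≤ W.analyticRank

/-- The GZK Selmer cell from the tree fact bsd.S17 (`rank_eq_analyticRank_of_analyticRank_le_one`:
rank = r_an ∧ Ш finite when r_an ≤ 1) and Greenberg's identity. -/
theorem gzkSelmerCell_of_fact (hGZK : rank_eq_analyticRank_of_analyticRank_le_one) : GZKSelmerCell := by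
  intro W _ p _ h1
  obtain ⟨hr, hfin⟩ := hGZK W h1
  haveI : Finite ↥(AddCommGroup.primaryComponent (↥W.sha) p) :=
    Finite.of_injective (fun x => (x : ↥W.sha)) Subtype.val_injective
  rw [W.selmerCorank_eq_mordellWeilRank_add_holds p, Literature.BSD.shaCorank_eq_zero_of_finite W p
    inferInstance, add_zero, hr]

/-- The parity cell is the pointwise ∀-closure of the tree fact bsd.S19. -/
theorem parityCell_of_fact
    (hpar : ∀ (W : WeierstrassCurve ℚ) [W.IsElliptic] (p : ℕ) [Fact p.Prime], selmerCorank_mod_two_eq W p) :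
    ParityCell :=
  fun W _ p _ => hpar W p

/-- **EXACTNESS**: the crux ⇔ (its GZK cell on the crux locus) ∧ (its parity consequence) ∧ UBSel4;
in particular GZK ∧ parity ∧ UBSel4 ⟹ crux (the p-converse theorems are NOT needed for UB: corank ≤ 2
is below any r_an ≥ 2, and corank = 3 forces r_an odd, hence ≥ 3). -/
theorem crux_of_cells (hG : GZKSelmerCell) (hP : ParityCell) (hC : UBSel4) :
    ShadowIsolation.SelmerRankUB := by
  intro W _ _ p _ h5 hg ho hs
  by_cases h1 : W.analyticRank ≤ 1
  · exact (hG W p h1).le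
  · push Not at h1
    have hpar := hP W p
    by_cases h4 : 4 ≤ W.selmerCorank p
    · exact hC W p h5 hg ho hs (by omega) h4 hpar
    · omega

/-- Conversely the open core is literally the crux on its open locus. -/
theorem ubSel4_of_crux (h : ShadowIsolation.SelmerRankUB) : UBSel4 :=
  fun W _ _ p _ h5 hg ho hs _ _ _ => h W p h5 hg ho hs

/-- The open core of the crux versus the open core `UBE4` of stmt-0145 (census v3 §D8,
`LeadingTermSqueezeUBR2ThreeCells`): on the big-image locus, UBSel4 ⇐ UBE4 ∧ child B, so after the
split the two chains have ONE open cell. -/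
theorem ubSel4_of_ube4_of_shaCotorsion
    (hUBE4 : ∀ (W : WeierstrassCurve ℚ) [W.IsElliptic] [W.IsGloballyMinimal],
      4 ≤ W.mordellWeilRank → 2 ≤ W.analyticRank →
        W.mordellWeilRank % 2 = W.analyticRank % 2 → W.mordellWeilRank ≤ W.analyticRank)
    (hB : ShaCotorsionBigImage) : UBSel4 := by
  intro W _ _ p _ h5 hg ho hs h2 h4 hpar
  rw [W.selmerCorank_eq_mordellWeilRank_add_holds p, hB W p h5 hg ho hs, add_zero] at h4 hpar ⊢
  exact hUBE4 W h4 h2 hpar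

/-! ## §6 The cyclotomic line (Kato 18.4 + p-adic/complex order comparison) and why it is strictly harder -/

/-- `PCO≥2`: at a big-image good ordinary `p ≥ 5` and analytic rank ≥ 2, the Mazur–Swinnerton-Dyer
p-adic L-function vanishes at `T = 0` to order AT MOST `ord_{s=1} L(E,s)` ("no excess p-adic zeros").
The ≤-half of route PAdicOrderV2's crux `PAdicOrderComparisonR2` (stmt-0489) restricted to r_an ≥ 2
(restriction needed: at r_an = 1 the comparison is rank-one Schneider, OPEN, while UB is GZK there). -/
def PCOTwoLe : Prop :=
  ∀ (W : WeierstrassCurve ℚ) [W.IsElliptic] [W.IsGloballyMinimal] (p : ℕ) [Fact p.Prime],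
    5 ≤ p → W.HasGoodReductionAtPrime p → ¬ (p : ℤ) ∣ W.frobeniusTrace p →
    W.HasSurjectiveModNGaloisRep p → 2 ≤ W.analyticRank →
    ∀ {N : ℕ} [NeZero N] (f : CuspForm (CongruenceSubgroup.Gamma0 N) 2),
      ModularForms.IsNewformOf W f →
      (padicLFunction f (unitRoot W p : ℚ_[p])).order ≤ (W.analyticRank : ℕ∞)

/-- Modularity packaged as the existence of SOME newform of `W` (consequence of the tree fact
`exists_isNewformOf`, Breuil–Conrad–Diamond–Taylor). -/
def HasNewform : Prop :=
  ∀ (W : WeierstrassCurve ℚ) [W.IsElliptic],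
    ∃ (N : ℕ) (_ : NeZero N) (f : CuspForm (CongruenceSubgroup.Gamma0 N) 2), ModularForms.IsNewformOf W f

/-- THE CYCLOTOMIC LINE, kernel-checked: Kato's corank bound (tree fact, Kato 2004 Thm 18.4) ∧ modularity ∧
GZK cell ∧ PCO≥2 ⟹ crux. Its open stub PCO≥2 is, modulo the PROVED cyclotomic IMC (BCS 2025) and Mazur
control, `corank + (Jordan excess of T on X(E/ℚ_∞)) ≤ r_an` = UB ∧ T-semisimplicity (Greenberg Conj 1.12 /
Schneider; route item stmt-0509): strictly harder than the crux (census §Transfer T5 / §Strengthen S2). -/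
theorem crux_of_kato_of_pco
    (hK : ∀ (W : WeierstrassCurve ℚ) [W.IsElliptic] [W.IsGloballyMinimal] (p : ℕ) [Fact p.Prime]
      {N : ℕ} [NeZero N] {f : CuspForm (CongruenceSubgroup.Gamma0 N) 2},
      kato_selmerCorank_le_order_padicLFunction W p (f := f))
    (hmod : HasNewform) (hG : GZKSelmerCell) (hP : PCOTwoLe) : ShadowIsolation.SelmerRankUB := by
  intro W _ _ p hp h5 hg ho hs
  by_cases h1 : W.analyticRank ≤ 1
  · exact (hG W p h1).le
  · push Not at h1
    obtain ⟨N, hN, f, hf⟩ := hmod W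
    have hp2 : p ≠ 2 := by omega
    have hord : IsOrdinaryAt W p := (isOrdinaryAt_iff W p).2 ⟨hg, ho⟩
    have hle : (W.selmerCorank p : ℕ∞) ≤ (W.analyticRank : ℕ∞) :=
      (hK W p hp2 hord hf).trans (hP W p h5 hg ho hs (by omega) f hf)
    exact_mod_cast hle

/-! ## §7 Typed S⁺ candidates (strengthenings considered in the census) -/

/-- S⁺₁ p^∞-Selmer BSD at the prime (UB ∧ LB): no induction variable; = SelmerRank's pair 0130 ∧ 0131. -/
def SelmerBSDBigImage : Prop :=
  ∀ (W : WeierstrassCurve ℚ) [W.IsElliptic] [W.IsGloballyMinimal] (p : ℕ) [Fact p.Prime],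
    5 ≤ p → W.HasGoodReductionAtPrime p → ¬ (p : ℤ) ∣ W.frobeniusTrace p →
    W.HasSurjectiveModNGaloisRep p → W.selmerCorank p = W.analyticRank

/-- S⁺₂ UB at EVERY prime (bad, supersingular, small-image, 2, 3 included) — census stmt-0132 §Decomposition
`SelmerUBAllPrimes`; strictly harder and consumed by no deciding theorem. -/
def SelmerUBAllPrimes : Prop :=
  ∀ (W : WeierstrassCurve ℚ) [W.IsElliptic] (p : ℕ) [Fact p.Prime], W.selmerCorank p ≤ W.analyticRank

/-- S⁺₃ the p-converse ladder at the prime ("corank = r ⟹ r_an = r" for every r): contains UB as its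
upward half; growth in print is entirely at r ≤ 1 (Skinner, BSTW, Yan–Zhu = tree facts). -/
def PConverseLadder : Prop :=
  ∀ (W : WeierstrassCurve ℚ) [W.IsElliptic] [W.IsGloballyMinimal] (p : ℕ) [Fact p.Prime],
    5 ≤ p → W.HasGoodReductionAtPrime p → ¬ (p : ℤ) ∣ W.frobeniusTrace p →
    W.HasSurjectiveModNGaloisRep p → ∀ r : ℕ, W.selmerCorank p = r → W.analyticRank = r

theorem crux_of_selmerBSD (h : SelmerBSDBigImage) : ShadowIsolation.SelmerRankUB :=
  fun W _ _ p _ h5 hg ho hs => (h W p h5 hg ho hs).le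

theorem crux_of_allPrimes (h : SelmerUBAllPrimes) : ShadowIsolation.SelmerRankUB :=
  fun W _ _ p _ _ _ _ _ => h W p

theorem crux_of_pConverseLadder (h : PConverseLadder) : ShadowIsolation.SelmerRankUB :=
  fun W _ _ p _ h5 hg ho hs => (h W p h5 hg ho hs _ rfl).ge

/-! ## §8 The TAME sibling: Kurihara-number ignition ⟺ crux, modulo Kim's structure theorems (both tree facts)

`TameIgnition` is the (a)-half of the Kolyvagin-system paradigm for the tame system (Mazur–Tate θ-elements /
Kurihara numbers): "at (E, p) in scope some Kurihara number of depth ≤ r_an(E) is non-zero". The (b)-half is Kim's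
cap `Kim2022_selmerCorank_le_of_kuriharaNumber_ne_zero` (theorem in print, tree fact). The two theorems below
certify the census verdict "costume, not transfer": TameIgnition implies the crux given the cap, and is implied by
the crux given Kim's existence clause `Kim2022_exists_kuriharaNumber_ne_zero_of_selmerCorank` — so modulo Kim's
structure theorem it IS the crux. Its one merit is logical form: Σ⁰₁ per instance (a finite modular-symbol
computation certifies the crux at a given (E, p)). -/

/-- TAME IGNITION at every (E, p) in scope: some Kurihara number `δ_n(E, p^k)` with `ν(n) ≤ ord_{s=1} L(E,s)` is
non-zero (for the newform `f` of `E` under the explicit period transfer of Kim's normalisation). -/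
def TameIgnition : Prop :=
  ∀ (W : WeierstrassCurve ℚ) [W.IsElliptic] [W.IsGloballyMinimal] (p : ℕ) [Fact p.Prime],
    5 ≤ p → W.HasGoodReductionAtPrime p → ¬ (p : ℤ) ∣ W.frobeniusTrace p →
    W.HasSurjectiveModNGaloisRep p →
    ∀ {N : ℕ} [NeZero N] (f : CuspForm (CongruenceSubgroup.Gamma0 N) 2), ModularForms.IsNewformOf W f →
    (∃ u : ℚ, ‖(u : ℚ_[p])‖ = 1 ∧ W.realPeriodRat = u * ModularForms.plusPeriod f) →
    ∃ (k n : ℕ) (_ : NeZero n), 1 ≤ k ∧ Kato.IsKolyvaginProduct W p k n ∧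
      n.primeFactors.card ≤ W.analyticRank ∧
      ∃ ψ : (ℓ : ℕ) → (ZMod ℓ)ˣ →* Multiplicative (ZMod (p ^ k)),
        (∀ ℓ ∈ n.primeFactors, Function.Surjective (ψ ℓ)) ∧ kuriharaNumber f (p ^ k) n ψ ≠ 0

/-- Modularity + Kim's period normalisation, packaged: every (E, p) in scope has a newform with the explicit
period transfer (tree: `exists_isNewformOf` + `realPeriodRat_eq_unit_mul_plusPeriod`-type statements). -/
def HasNewformWithPeriodTransfer : Prop :=
  ∀ (W : WeierstrassCurve ℚ) [W.IsElliptic] [W.IsGloballyMinimal] (p : ℕ) [Fact p.Prime],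
    5 ≤ p → W.HasGoodReductionAtPrime p → ¬ (p : ℤ) ∣ W.frobeniusTrace p →
    W.HasSurjectiveModNGaloisRep p →
    ∃ (N : ℕ) (_ : NeZero N) (f : CuspForm (CongruenceSubgroup.Gamma0 N) 2), ModularForms.IsNewformOf W f ∧
      ∃ u : ℚ, ‖(u : ℚ_[p])‖ = 1 ∧ W.realPeriodRat = u * ModularForms.plusPeriod f

/-- (b)-half in print ⟹ [TameIgnition ⟹ crux]. -/
theorem crux_of_tameIgnition (hcap : Kim2022_selmerCorank_le_of_kuriharaNumber_ne_zero)
    (hmod : HasNewformWithPeriodTransfer) (h : TameIgnition) : ShadowIsolation.SelmerRankUB := by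
  intro W _ _ p _ h5 hg ho hs
  obtain ⟨N, hN, f, hf, hu⟩ := hmod W p h5 hg ho hs
  obtain ⟨k, n, hn, hk, hkol, hcard, ψ, hψ, hδ⟩ := h W p h5 hg ho hs f hf hu
  exact (hcap W p h5 hg ho hs f hf hu k n hk hkol ψ hψ hδ).trans hcard

/-- Kim's existence clause ⟹ [crux ⟹ TameIgnition]: the ignition is a CONSEQUENCE of the crux — so, modulo Kim's
structure theorem, TameIgnition and the crux are the same statement (costume). -/
theorem tameIgnition_of_crux (hex : Kim2022_exists_kuriharaNumber_ne_zero_of_selmerCorank)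
    (h : ShadowIsolation.SelmerRankUB) : TameIgnition := by
  intro W _ _ p _ h5 hg ho hs N _ f hf hu
  obtain ⟨k, n, hn, hk, hkol, hcard, ψ, hψ, hδ⟩ := hex W p h5 hg ho hs f hf hu
  exact ⟨k, n, hn, hk, hkol, hcard.trans (h W p h5 hg ho hs), ψ, hψ, hδ⟩

end Summit.BirchSwinnertonDyer.BirchSwinnertonDyer.Cruxes.SelmerRankUB.Census
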